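import Literature.NumberTheory.Automorphic.ArchInnerFormCartanAtlas            -- ★ (T-ATLAS) PART 2b: `gprimeTorus`, `gprimeBlock`, `boostEig`, charpolys
import Literature.NumberTheory.Automorphic.ArchEndoscopicCartanAtlasRegular   -- ★ PART 1b: `archWeylDiscr_diagonal_ne_zero_iff` (+ `mixedSpace_ext`, `coe_archPiEquivCM_apply`)
import Literature.NumberTheory.Automorphic.ArchCartanCoordinates              -- ★ (COORD): `ArchCartan.RegG`, `mem_regG_iff`
import HarnessLib

/-!
# Regularity on the Cartan atlas of `G′_∞ = U(diag α)(L⁺ ⊗ ℝ)` in coordinates ((T-ATLAS) PART 2c; Rogawski 1990 §3.1, §4.3; Shelstad 1979 §4)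

Topic `NumberTheory/Automorphic`; namespace `Literature.NumberTheory.Automorphic.UnitaryGroup`.  THEOREMS ONLY (no `def`, no instance, no notation, no axiom, no
named fact, no `sorry`).  Cell `pub/hodgecm-mathlib`, crux H413 (`stmt-HodgeConjecture-24833`), F0∕P3c line LH3, DIRECT ROAD of `stub_N9`; seat LH3-p03 (g2), organ
(T-ATLAS) PART 2 of LH3-plan (g2) (frame ruling 05:28:27Z, convention ruling 05:46:06Z, PACK-SPEC v1 §2: `orbFamG` is read on `RegG S′`).  Count-neutral.

THE MATHEMATICS.  House frame: `H′ = diagonal α`, and the chart `gprimeTorus L α S′ c` (★ PART 2b) with `S′ ⊆ splitChartPlaces L α` (every `w ∈ S′` an indefinite place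
with real form — then the `w`-component IS the boost).  The place-`w` characteristic polynomial of `gprimeTorus α S′ c` is `∏_i (X − λ_{w,i})` with the eigenvalue
triple `λ_w = boostEig (c w) = (e^{x_w+iθ_w}, e^{iφ_w}, e^{−x_w+iθ_w})` at `w ∈ S′` (★ `charpoly_gprimeSplitMatrix`, through the eigen-factorisation `B = P D P⁻¹`) and
`(e^{ic_w0}, e^{ic_w1}, e^{ic_w2})` at `w ∉ S′` (★ `charpoly_coe_gprimeCptGL`); hence, coefficientwise over `L ⊗ ℝ` (★ `mixedSpace_ext`), `charpoly (gprimeTorus α S′ c) =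
charpoly diag(d)`, `d_i = (λ_{w,i})_w`, and (★ `archWeylDiscr_ne_zero_iff`, ★ `archWeylDiscr_diagonal_ne_zero_iff`) **`gprimeTorus α S′ c` is regular iff `λ_w` is
injective at every place iff `c ∈ RegG S′`** ((COORD): pairwise distinct unit eigenvalues off `S′`, `x_w ≠ 0` on `S′`).
* `charpoly_map_evalC_gprimeTorus`, `isRegularElt_gprimeTorus_iff_forall_injective`, **`isRegularElt_gprimeTorus_iff`**, **`isRegularElt_gprimeTorus_iff_mem_regG`**.
HONEST LABEL: HC_CM is proved only modulo the 7 printed citations (2 remaining: hLiu418 = `stmt-HodgeConjecture-24832`, h413 = `stmt-HodgeConjecture-24833`) until rung 0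
closes; regularity bookkeeping on the chart, count-neutral (+0∕+0).

## References
* [Rogawski1990] J. D. Rogawski, *Automorphic Representations of Unitary Groups in Three Variables*, Ann. of Math. Stud. 123 (1990), §3.1 p. 19 (regular elements),
  §4.3 p. 42, §3.6 p. 31.
* [Shelstad1979] D. Shelstad, *Characters and inner forms of a quasi-split group over ℝ*, Compositio Math. 39 (1979), §4 p. 22 (`T_reg`).
-/

set_option autoImplicit false

noncomputable section

open NumberField NumberField.InfinitePlace NumberField.mixedEmbedding Matrix Complex Polynomial
open scoped MatrixGroups Matrix ComplexConjugate Real Classical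

namespace Literature.NumberTheory.Automorphic.UnitaryGroup

open Literature.NumberTheory.Rogawski1990

section Regular

variable (L : Type) [Field L] [NumberField L] [IsCMField L] (α : Fin 3 → L)

/-- `![a, b, c]` is injective when its entries are pairwise distinct. [folklore] -/
private theorem injective_vec3' {a b d : ℂ} (hab : a ≠ b) (had : a ≠ d) (hbd : b ≠ d) : Function.Injective (![a, b, d] : Fin 3 → ℂ) := by
  intro i j h
  fin_cases i <;> fin_cases j
  all_goals first
    | rfl
    | (exfalso; simp at h; first | exact hab h | exact had h | exact hbd h | exact hab h.symm | exact had h.symm | exact hbd h.symm)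

/-- **`boostEig c` is injective iff `x = c 0 ≠ 0`** (`|e^{±x+iθ}| = e^{±x} ≠ 1 = |e^{iφ}|`, `e^{x} ≠ e^{−x}`; at `x = 0` the entries `0, 2` coincide). [cite: Shelstad1979, §4 p. 22] -/
theorem injective_boostEig_iff (c : Fin 3 → ℝ) : Function.Injective (boostEig c) ↔ c 0 ≠ 0 := by
  constructor
  · intro hi h0
    have heq : boostEig c 0 = boostEig c 2 := by simp [boostEig, h0]
    exact absurd (hi heq) (by decide)
  · intro hx
    have n0 : ‖Complex.exp ((c 0 : ℂ) + (c 2 : ℂ) * I)‖ = Real.exp (c 0) := by rw [Complex.norm_exp]; simp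
    have n2 : ‖Complex.exp (-(c 0 : ℂ) + (c 2 : ℂ) * I)‖ = Real.exp (-(c 0)) := by rw [Complex.norm_exp]; simp
    have n1 : ‖Complex.exp ((c 1 : ℂ) * I)‖ = 1 := by rw [Complex.norm_exp]; simp
    have hne01 : Real.exp (c 0) ≠ 1 := by rw [Ne, Real.exp_eq_one_iff]; exact hx
    have hne21 : Real.exp (-(c 0)) ≠ 1 := by rw [Ne, Real.exp_eq_one_iff, neg_eq_zero]; exact hx
    have hne02 : Real.exp (c 0) ≠ Real.exp (-(c 0)) := by
      rw [Ne, Real.exp_eq_exp]; intro h; exact hx (by linarith)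
    refine injective_vec3' (fun h => hne01 ?_) (fun h => hne02 ?_) (fun h => hne21 ?_)
    · rw [← n0, h, n1]
    · rw [← n0, h, n2]
    · rw [← n2, ← h, n1]

variable (S' : Finset {w : InfinitePlace L // IsComplex w}) (c : {w : InfinitePlace L // IsComplex w} → Fin 3 → ℝ)

/-- **THE PLACE-`w` CHARACTERISTIC POLYNOMIAL OF `gprimeTorus α S′ c`** (`S′ ⊆` split-chart places): `∏_i (X − λ_{w,i})` with `λ_w = boostEig (c w)` at `w ∈ S′`
and `λ_{w,i} = e^{i c_w i}` at `w ∉ S′` (★ `coe_archPiEquivCM_apply`, ★ `charpoly_gprimeSplitMatrix`, ★ `charpoly_coe_gprimeCptGL`). [cite: Rogawski1990, §4.3 p. 42] -/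
theorem charpoly_map_evalC_gprimeTorus (hS' : ∀ w, w ∈ S' → w ∈ splitChartPlaces L α) (w : {w : InfinitePlace L // IsComplex w}) :
    ((((gprimeTorus L α S' c : arch (↥(maximalRealSubfield L)) L (IsCMField.complexConj L) 3 (Matrix.diagonal α)) : GL (Fin 3) (mixedSpace L)) :
        Matrix (Fin 3) (Fin 3) (mixedSpace L)).map (evalC L w)).charpoly =
      ∏ i : Fin 3, (X - Polynomial.C ((if w ∈ S' then boostEig (c w) else fun i => Complex.exp ((c w i : ℂ) * I)) i)) := by
  have hmap : (((gprimeTorus L α S' c : arch (↥(maximalRealSubfield L)) L (IsCMField.complexConj L) 3 (Matrix.diagonal α)) : GL (Fin 3) (mixedSpace L)) :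
        Matrix (Fin 3) (Fin 3) (mixedSpace L)).map (evalC L w) =
      (((gprimeBlock L α w S' c : ↥(archLocal L 3 (Matrix.diagonal α) w)) : GL (Fin 3) ℂ) : Matrix (Fin 3) (Fin 3) ℂ) := by
    have h1 : (Matrix.GeneralLinearGroup.map (evalC L w)
        ((gprimeTorus L α S' c : arch (↥(maximalRealSubfield L)) L (IsCMField.complexConj L) 3 (Matrix.diagonal α)) : GL (Fin 3) (mixedSpace L)) :
          Matrix (Fin 3) (Fin 3) ℂ) =
        (((gprimeTorus L α S' c : arch (↥(maximalRealSubfield L)) L (IsCMField.complexConj L) 3 (Matrix.diagonal α)) : GL (Fin 3) (mixedSpace L)) :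
          Matrix (Fin 3) (Fin 3) (mixedSpace L)).map (evalC L w) := rfl
    rw [← h1, ← coe_archPiEquivCM_apply, archPiEquivCM_gprimeTorus]
  rw [hmap]
  by_cases hw : w ∈ S'
  · rw [if_pos hw, coe_gprimeBlock_of_mem L α c hw (hS' w hw), coe_gprimeSplitGL]
    exact charpoly_gprimeSplitMatrix _ _ (hS' w hw).2 (c w)
  · rw [if_neg hw, coe_gprimeBlock_of_not_mem L α c hw]
    exact charpoly_coe_gprimeCptGL _ (c w)

/-- **`gprimeTorus α S′ c` is regular iff its eigenvalue triple is injective at every complex place** (`charpoly = charpoly diag(d)` over `L ⊗ ℝ` coefficientwise from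
the places, ★ `mixedSpace_ext`; then ★ `archWeylDiscr_ne_zero_iff` + ★ `archWeylDiscr_diagonal_ne_zero_iff`). [cite: Rogawski1990, §3.1 p. 19; §4.3 p. 42] -/
theorem isRegularElt_gprimeTorus_iff_forall_injective (hS' : ∀ w, w ∈ S' → w ∈ splitChartPlaces L α) :
    IsRegularElt ((gprimeTorus L α S' c : arch (↥(maximalRealSubfield L)) L (IsCMField.complexConj L) 3 (Matrix.diagonal α)) : GL (Fin 3) (mixedSpace L)) ↔
      ∀ w : {w : InfinitePlace L // IsComplex w}, Function.Injective (if w ∈ S' then boostEig (c w) else fun i => Complex.exp ((c w i : ℂ) * I)) := by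
  -- the comparison diagonal over `L ⊗ ℝ`
  set d : Fin 3 → mixedSpace L := fun i => ((0 : {w : InfinitePlace L // IsReal w} → ℝ),
    fun w => (if w ∈ S' then boostEig (c w) else fun i => Complex.exp ((c w i : ℂ) * I)) i) with hd
  have hchar : ((((gprimeTorus L α S' c : arch (↥(maximalRealSubfield L)) L (IsCMField.complexConj L) 3 (Matrix.diagonal α)) : GL (Fin 3) (mixedSpace L)) :
        Matrix (Fin 3) (Fin 3) (mixedSpace L))).charpoly = (Matrix.diagonal d).charpoly := by
    apply Polynomial.ext
    intro n
    refine mixedSpace_ext (↥(maximalRealSubfield L)) L (IsCMField.complexConj L) (IsCMField.complexConj_ne_one L) (complexConj_smul_infinitePlace L) fun w => ?_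
    have h1 : (evalC L w) (((((gprimeTorus L α S' c : arch (↥(maximalRealSubfield L)) L (IsCMField.complexConj L) 3 (Matrix.diagonal α)) : GL (Fin 3) (mixedSpace L)) :
        Matrix (Fin 3) (Fin 3) (mixedSpace L))).charpoly.coeff n) =
        (∏ i : Fin 3, (X - Polynomial.C ((if w ∈ S' then boostEig (c w) else fun i => Complex.exp ((c w i : ℂ) * I)) i))).coeff n := by
      rw [← Polynomial.coeff_map, ← Matrix.charpoly_map, charpoly_map_evalC_gprimeTorus L α S' c hS']
    have h2 : (evalC L w) ((Matrix.diagonal d).charpoly.coeff n) =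
        (∏ i : Fin 3, (X - Polynomial.C ((if w ∈ S' then boostEig (c w) else fun i => Complex.exp ((c w i : ℂ) * I)) i))).coeff n := by
      rw [← Polynomial.coeff_map, ← Matrix.charpoly_map, Matrix.diagonal_map (map_zero _), Matrix.charpoly_diagonal]
      rfl
    exact h1.trans h2.symm
  rw [← archWeylDiscr_ne_zero_iff, archWeylDiscr_def, show Matrix.discr ((((gprimeTorus L α S' c : arch (↥(maximalRealSubfield L)) L (IsCMField.complexConj L) 3
      (Matrix.diagonal α)) : GL (Fin 3) (mixedSpace L)) : Matrix (Fin 3) (Fin 3) (mixedSpace L))) = Matrix.discr (Matrix.diagonal d) by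
    simp only [Matrix.discr]; rw [hchar], ← archWeylDiscr_def, archWeylDiscr_diagonal_ne_zero_iff]

/-- **REGULARITY OF THE `G′`-CHART IN COORDINATES**: for `S′ ⊆` split-chart places, `gprimeTorus α S′ c` is regular iff at every place `w ∉ S′` the three unit eigenvalues
`e^{ic_w0}, e^{ic_w1}, e^{ic_w2}` are pairwise distinct and at every `w ∈ S′` `x_w = c w 0 ≠ 0`. [cite: Rogawski1990, §3.1 p. 19; §4.3 p. 42] [cite: Shelstad1979, §4 p. 22] -/
theorem isRegularElt_gprimeTorus_iff (hS' : ∀ w, w ∈ S' → w ∈ splitChartPlaces L α) :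
    IsRegularElt ((gprimeTorus L α S' c : arch (↥(maximalRealSubfield L)) L (IsCMField.complexConj L) 3 (Matrix.diagonal α)) : GL (Fin 3) (mixedSpace L)) ↔
      (∀ w, w ∉ S' → Function.Injective fun i : Fin 3 => Circle.exp (c w i)) ∧ (∀ w, w ∈ S' → c w 0 ≠ 0) := by
  rw [isRegularElt_gprimeTorus_iff_forall_injective L α S' c hS']
  have hcirc : ∀ w : {w : InfinitePlace L // IsComplex w},
      Function.Injective (fun i : Fin 3 => Circle.exp (c w i)) ↔ Function.Injective (fun i : Fin 3 => Complex.exp ((c w i : ℂ) * I)) := by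
    intro w
    constructor
    · intro h i j hij
      exact h (Circle.ext (by rw [Circle.coe_exp, Circle.coe_exp]; exact hij))
    · intro h i j hij
      exact h (by have := congrArg (fun z : Circle => (z : ℂ)) hij; simpa only [Circle.coe_exp] using this)
  constructor
  · intro h
    refine ⟨fun w hw => ?_, fun w hw => ?_⟩
    · have h' := h w
      rw [if_neg hw] at h'
      exact (hcirc w).2 h'
    · have h' := h w
      rw [if_pos hw] at h'
      exact (injective_boostEig_iff (c w)).1 h'
  · rintro ⟨hc, hs⟩ w
    by_cases hw : w ∈ S'
    · rw [if_pos hw]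
      exact (injective_boostEig_iff (c w)).2 (hs w hw)
    · rw [if_neg hw]
      exact (hcirc w).1 (hc w hw)

/-- **… iff `c ∈ RegG S′`** — the (COORD) regular set of the `G′`-Cartan of type `S′` (★ `ArchCartan.mem_regG_iff`). [cite: Shelstad1979, §4 p. 22] [cite: Rogawski1990, §3.1 p. 19] -/
theorem isRegularElt_gprimeTorus_iff_mem_regG (hS' : ∀ w, w ∈ S' → w ∈ splitChartPlaces L α) :
    IsRegularElt ((gprimeTorus L α S' c : arch (↥(maximalRealSubfield L)) L (IsCMField.complexConj L) 3 (Matrix.diagonal α)) : GL (Fin 3) (mixedSpace L)) ↔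
      c ∈ ArchCartan.RegG S' := by
  rw [isRegularElt_gprimeTorus_iff L α S' c hS', ArchCartan.mem_regG_iff]

end Regular

end Literature.NumberTheory.Automorphic.UnitaryGroup

end
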